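import Literature.Computability.Complexity.FPRASTransfer
import Literature.Computability.Complexity.FPStringBricks
import Literature.Computability.Complexity.LengthCompare
import Literature.Computability.Complexity.FoldBricks
import Literature.Computability.Complexity.HashBricks

set_option linter.dupNamespace false

/-!
# Stub FF2 `stub_fprasDecider` of the line `SketchIdeator1` for crux stmt-PneNP-2717
`Summit.PneNP.PneNP.Theses.PhaseTwins.NoFBPPApproxAboveUniqueness`

The one-bit decider driven by an FPRAS transducer is in `FP`. On the pair `⟨y, u⟩` (instance `y`,
coins `u`) the machine computes the instance code `x = f₁ y`, cuts the coins to the prefix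
`u ↾ c(|x| + 1 + 4)`, assembles the canonical counting query `countQuery x 0 1 4 (u ↾ ℓ)` (accuracy
`1`, confidence `4`), runs `F` on it, re-reads the answer as the canonical numeral
`⌜E⌝ = canonF (F …) = encodeNat (decodeNat (F …))` (`E = countEstimate F x 0 1 4 (u ↾ ℓ)`), builds the
unary yardstick `1^{K · |hdr y|}` (`HashBricks.umulFn`) and answers `[K · |hdr y| ≤ |⌜E⌝|]` by the
length test `lenLeFn X`. Brick algebra only (`Brick.fstF/sndF`, `Plumb.polyFn/takeFn`, `fanoutFn`,
`append_mem_FP`, `const_mem_FP`, `umulFn`, `canonF`, `lenLeFn`), in the style of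
`Negative.hasFPRAS_of_padded` (`Negative/FPRASDictionary.lean`); no machine is written and no
definition is introduced.
-/

namespace Summit.PneNP.PneNP.Theorems.NoFBPPApproxAboveUniqueness

open Literature.Computability.Complexity _root_.Computability Polynomial Brick Plumb OracleCompose HashBricks

/-- **Stub FF2 (the FPRAS-driven decider is in `FP`).** Given an instance map `f₁`, a unary header map
`hdr`, a transducer `F` (all in `FP`), a coin polynomial `c` and a constant `K`, the one-bit map
`⟨y, u⟩ ↦ [K · |hdr y| ≤ |⌜E⌝|]`, `E = countEstimate F (f₁ y) 0 1 4 (u ↾ c(|f₁ y| + 1 + 4))` (the FPRAS run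
at accuracy `1`, confidence `4` on the first `c(|f₁ y| + 1 + 4)` coins, its answer re-read as a canonical
numeral `canonF`, whose length is compared with the unary yardstick `1^{K |hdr y|}` by `lenLeFn X`) is in
`FP` and one-bit on every input. [folklore] -/
theorem stub_fprasDecider {f₁ hdr F : List Bool → List Bool} (hf₁ : f₁ ∈ FP) (hhdr : hdr ∈ FP) (hF : F ∈ FP)
    (c : Polynomial ℕ) (K : ℕ) :
    ∃ D ∈ FP, (∀ w, D w = [true] ∨ D w = [false]) ∧ ∀ y u : List Bool,
      D (boolPair y u) = [decide (K * (hdr y).length ≤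
        (encodeNat (countEstimate F (f₁ y) 0 1 4 (u.take (c.eval ((f₁ y).length + 1 + 4))))).length)] := by
  -- the pieces of the decider: `x = f₁ y`, `hdr y`, the yardstick `1^{K |hdr y|}`, the ruler
  -- `1^{c(|x| + 1 + 4)}`, the cut coins, the query, the canonical numeral of the answer
  set xF : List Bool → List Bool := f₁ ∘ fstF with hxF
  set mF : List Bool → List Bool := hdr ∘ fstF with hmF
  set KF : List Bool → List Bool := fun _ => ones K with hKF
  set kmF : List Bool → List Bool := umulFn ∘ fanoutFn KF mF with hkmF
  set oneF : List Bool → List Bool := fun _ => [true] with honeF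
  set fourF : List Bool → List Bool := fun _ => ones 4 with hfourF
  set sF : List Bool → List Bool := fun w => (xF w ++ oneF w) ++ fourF w with hsF
  set rulerF : List Bool → List Bool := polyFn c ∘ sF with hrulerF
  set uF : List Bool → List Bool := takeFn ∘ fanoutFn rulerF sndF with huF
  set parF : List Bool → List Bool :=
    fun _ => boolPair (unaryEncodeNat 0) (boolPair (unaryEncodeNat 1) (unaryEncodeNat 4)) with hparF
  set qF : List Bool → List Bool := fanoutFn (fanoutFn xF parF) uF with hqF
  set eF : List Bool → List Bool := canonF ∘ F ∘ qF with heF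
  -- `FP` membership
  have hxFP : xF ∈ FP := comp_mem_FP hf₁ fstF_mem_FP
  have hmFP : mF ∈ FP := comp_mem_FP hhdr fstF_mem_FP
  have hKFP : KF ∈ FP := const_mem_FP _
  have hkmFP : kmF ∈ FP := comp_mem_FP umulFn_mem_FP (fanoutFn_mem_FP hKFP hmFP)
  have honeFP : oneF ∈ FP := const_mem_FP _
  have hfourFP : fourF ∈ FP := const_mem_FP _
  have hsFP : sF ∈ FP := append_mem_FP (append_mem_FP hxFP honeFP) hfourFP
  have hrulerFP : rulerF ∈ FP := comp_mem_FP (polyFn_mem_FP c) hsFP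
  have huFP : uF ∈ FP := comp_mem_FP takeFn_mem_FP (fanoutFn_mem_FP hrulerFP sndF_mem_FP)
  have hparFP : parF ∈ FP := const_mem_FP _
  have hqFP : qF ∈ FP := fanoutFn_mem_FP (fanoutFn_mem_FP hxFP hparFP) huFP
  have heFP : eF ∈ FP := comp_mem_FP canonF_mem_FP (comp_mem_FP hF hqFP)
  refine ⟨lenLeFn X ∘ fanoutFn eF kmF,
    comp_mem_FP (lenLeFn_mem_FP X) (fanoutFn_mem_FP heFP hkmFP),
    fun w => lenLeFn_eq_or X (fanoutFn eF kmF w), fun y u => ?_⟩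
  -- semantics of the pieces on `⟨y, u⟩`
  have hx : xF (boolPair y u) = f₁ y := by
    simp only [hxF, Function.comp_apply, fstF_boolPair]
  have hm : mF (boolPair y u) = hdr y := by
    simp only [hmF, Function.comp_apply, fstF_boolPair]
  have hkm : kmF (boolPair y u) = ones (K * (hdr y).length) := by
    simp only [hkmF, hKF, Function.comp_apply, fanoutFn_apply, hm, umulFn_apply, fstF_boolPair,
      sndF_boolPair, List.length_replicate]
  have hs : (sF (boolPair y u)).length = (f₁ y).length + 1 + 4 := by
    simp only [hsF, honeF, hfourF, hx, List.length_append, List.length_singleton,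
      List.length_replicate]
  have hrul : rulerF (boolPair y u) = ones (c.eval ((f₁ y).length + 1 + 4)) := by
    simp only [hrulerF, Function.comp_apply, polyFn_apply, hs]
  have hu : uF (boolPair y u) = u.take (c.eval ((f₁ y).length + 1 + 4)) := by
    simp only [huF, Function.comp_apply, fanoutFn_apply, hrul, sndF_boolPair, takeFn_boolPair,
      List.length_replicate]
  have hq : qF (boolPair y u) = countQuery (f₁ y) 0 1 4 (u.take (c.eval ((f₁ y).length + 1 + 4))) := by
    simp only [hqF, hparF, fanoutFn_apply, hx, hu, countQuery]
  have he : eF (boolPair y u) =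
      encodeNat (countEstimate F (f₁ y) 0 1 4 (u.take (c.eval ((f₁ y).length + 1 + 4)))) := by
    simp only [heF, Function.comp_apply, hq, canonF_eq_encodeNat_decodeNat, countEstimate_def]
  simp only [Function.comp_apply, fanoutFn_apply, lenLeFn_boolPair, he, hkm, List.length_replicate,
    eval_X]

end Summit.PneNP.PneNP.Theorems.NoFBPPApproxAboveUniqueness
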